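import Summits.NavierStokesRegularity.NavierStokesRegularity.Theorems.SineMomentDoorDoors

/-!
# SineMomentDoorSeq — S27 «SineMomentDoor», the sequential upgrade T-transverse-seq

Landing (DIRECTOR-NS #88/#89, typer g20) of nsreg-p1 g22's ROUND-26 door file `r26/Sketch27.lean`
(sha16 b3e45f4d288a9931; farm rc 0, 0 sorry) as theorems-only tree files, statements and proofs VERBATIM,
split along the planner's section boundaries: `SineMomentDoorDefs` (§0 observable, §1 texts, §0′ elementary facts),
`SineMomentDoorSpread` (§2 (H1) zoom-closedness, §3 (H2) analytic spread, §4 (H3) stratum Liouville),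
`SineMomentDoorDoors` (§5 the doors, §6 the transverse-vorticity corollary), `SineMomentDoorSeq` (§7 the sequential
upgrade). This file: `oneSliceLiouville_uni`, `seqDoorAt_sine`, `TargetTransverseVorticitySeq`, `targetTransverseVorticitySeq_of`, `seqDoorAt_sine_holds`, `targetTransverseVorticitySeq_holds` (§7, over the landed I1 `StableStrataDoorAlongTimes.localPointZoomAlongTimesM_holds`); see `SineMomentDoorDefs` for the planner's full account.
WHAT THIS IS NOT: not NS regularity (`NoTypeII` untouched); an ε-criterion inside the Type-I class, MODEL-free.
-/

noncomputable section

open MeasureTheory Set Function Filter Topology TopologicalSpace Metric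
open scoped RealInnerProductSpace NNReal ENNReal Topology Pointwise ContDiff
open Literature.Analysis Literature.Analysis.FluidPDE
open Summit.NavierStokesRegularity.NavierStokesRegularity.Theorems.PoloidalWindowDoorPoloidalWindowRigidityWindow
open Summit.NavierStokesRegularity.NavierStokesRegularity.Theorems.ZoomReturnDoorDefs
open Summit.NavierStokesRegularity.NavierStokesRegularity.Theorems.StableStrataDoorDefs
open Summit.NavierStokesRegularity.NavierStokesRegularity.Theorems.StableStrataDoorWindowLimit
open Summit.NavierStokesRegularity.NavierStokesRegularity.Theorems.StableStrataDoorSchema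
open Summit.NavierStokesRegularity.NavierStokesRegularity.Theorems.StableStrataDoorInstances
open Summit.NavierStokesRegularity.NavierStokesRegularity.Theorems.LocalSineTubeDoorProfileAlignedWindowRigidity
open Summit.NavierStokesRegularity.NavierStokesRegularity.Theorems.LocalSineTubeDoorProfileAlignedWindowRigidityPlanarity

set_option linter.dupNamespace false

namespace Summit.NavierStokesRegularity.NavierStokesRegularity.Theorems.SineMomentDoor

/-! ## §7 THE SEQUENTIAL UPGRADE (modulo I1 = `StableStrataDoorOneSliceDefs.LocalPointZoomAlongTimesM` only): the
unidirectional-vorticity stratum has a ONE-SLICE Liouville theorem, so the landed sequential schema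
`StableStrataDoorOneSliceSeqDoor.seqDoorAt_of_liouville` applies — smallness along SOME sequence `tₙ → T⁻` suffices. -/

section Seq

open Summit.NavierStokesRegularity.NavierStokesRegularity.Theorems.StableStrataDoorOneSliceDefs
open Summit.NavierStokesRegularity.NavierStokesRegularity.Theorems.StableStrataDoorOneSliceSeqDoor
open Summit.NavierStokesRegularity.NavierStokesRegularity.Theorems.StableStrataDoorOneSliceAxiPropagation

/-- `c × e = 0` with `e ≠ 0` makes `c` a multiple of `e` (BAC − CAB). -/
theorem exists_eq_smul_of_cross_eq_zero {c e : EuclideanSpace ℝ (Fin 3)} (he : e ≠ 0) (h : cross c e = 0) :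
    ∃ a : ℝ, c = a • e := by
  have he2 : ‖e‖ ^ 2 ≠ 0 := pow_ne_zero 2 (norm_ne_zero_iff.2 he)
  have hbac : cross e (cross c e) = ⟪e, e⟫ • c - ⟪e, c⟫ • e := cross_cross_right e c e
  rw [h, ← crossCLM_apply, map_zero, real_inner_self_eq_norm_sq] at hbac
  refine ⟨⟪e, c⟫ / ‖e‖ ^ 2, ?_⟩
  rw [div_eq_inv_mul, mul_smul, ← sub_eq_zero.1 hbac.symm, smul_smul, inv_mul_cancel₀ he2, one_smul]

/-- **ONE-SLICE LIOUVILLE FOR THE UNIDIRECTIONAL-VORTICITY STRATUM (PROVED, kinematic):** a classical Type-I(`D`) solution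
on `(−∞,0) × ℝ³` ONE slice of which has vorticity everywhere parallel to one fixed direction vanishes identically.  The slice
is invariant under translations along that direction (tree `translationInvariant_of_curl_parallel` = Giga–Miura Prop. 2.2
step 1: `div curl = 0` + harmonic Liouville on the increments), hence zero by the Type-I spatial decay along the line; then
one-slice uniqueness (`eq_of_eq_slice_classical`) against the rest state.  No vorticity equation, no 2D Liouville theorem. -/
theorem oneSliceLiouville_uni (D : ℝ) : OneSliceLiouville uniStratum D := by
  intro V q hcl hdec s₀ hs₀ hmem τ hτ x
  obtain ⟨e, he, hcross⟩ := hmem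
  have hD : 0 ≤ D := nonneg_of_hasTypeIDecay hdec
  set a : ℝ := Real.sqrt (-s₀) with ha
  have ha0 : 0 < a := Real.sqrt_pos.2 (neg_pos.2 hs₀)
  have hdec₀ : ∀ y, ‖V s₀ y‖ ≤ D / (‖y‖ + a) := fun y => hdec s₀ hs₀ y
  -- the slice is translation invariant along `e`
  have hv2 : ContDiff ℝ 2 (V s₀) := (hcl.contDiff_velocity (by exact hs₀)).of_le (by norm_cast)
  have hinv : ∀ y (h : ℝ), V s₀ (y + h • e) = V s₀ y :=
    translationInvariant_of_curl_parallel hv2 (hcl.divFree s₀ hs₀)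
      ⟨D / a, fun y => (hdec₀ y).trans (div_le_div_of_nonneg_left hD ha0 (by linarith [norm_nonneg y]))⟩
      he (fun y => exists_eq_smul_of_cross_eq_zero he (hcross y))
  -- hence zero, by decay along the line `y + h e`
  have hslice0 : ∀ y, V s₀ y = 0 := by
    intro y
    by_contra hy
    set η : ℝ := ‖V s₀ y‖ with hη
    have hη0 : 0 < η := norm_pos_iff.2 hy
    have hen : 0 < ‖e‖ := norm_pos_iff.2 he
    set h : ℝ := (D / η + ‖y‖ + 1) / ‖e‖ with hh
    have hhe : ‖h • e‖ = D / η + ‖y‖ + 1 := by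
      rw [norm_smul, Real.norm_eq_abs, abs_of_nonneg (by rw [hh]; positivity), hh, div_mul_cancel₀ _ hen.ne']
    have hfar : D / η + 1 ≤ ‖y + h • e‖ := by
      have h1 : ‖h • e‖ ≤ ‖y + h • e‖ + ‖y‖ := by
        calc ‖h • e‖ = ‖(y + h • e) - y‖ := by rw [add_sub_cancel_left]
          _ ≤ ‖y + h • e‖ + ‖y‖ := norm_sub_le _ _
      linarith
    have hle : η ≤ D / (‖y + h • e‖ + a) := by rw [hη, ← hinv y h]; exact hdec₀ _
    have hden : 0 < ‖y + h • e‖ + a := by positivity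
    rw [le_div_iff₀ hden] at hle
    have h2 : η * (D / η + 1) ≤ η * (‖y + h • e‖ + a) := by
      exact mul_le_mul_of_nonneg_left (by linarith) hη0.le
    rw [mul_add, mul_div_cancel₀ _ hη0.ne', mul_one] at h2
    linarith
  -- one-slice uniqueness against the rest state
  have h0cl : IsClassicalNSSolutionOn (Set.Iio 0) 1 (0 : ℝ → EuclideanSpace ℝ (Fin 3) → EuclideanSpace ℝ (Fin 3)) 0 0 :=
    isClassicalNSSolutionOn_zero (Set.Iio 0) 1
  have h0dec : HasTypeIDecay 0 (0 : ℝ → EuclideanSpace ℝ (Fin 3) → EuclideanSpace ℝ (Fin 3)) := fun t _ y => by simp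
  have hsl : V s₀ = (0 : ℝ → EuclideanSpace ℝ (Fin 3) → EuclideanSpace ℝ (Fin 3)) s₀ := funext fun y => hslice0 y
  have hx := congrFun (eq_of_eq_slice_classical hcl hdec h0cl h0dec hs₀ hsl τ hτ) x
  simpa using hx

/-- **SEQUENTIAL door for the sine-moment observable, MODULO I1:** `SeqDoorAt (sinePhi U (cap ν M)) ν M`. -/
theorem seqDoorAt_sine (h₁ : LocalPointZoomAlongTimesM) {ν : ℝ} (hν : 0 < ν) {U : Set (EuclideanSpace ℝ (Fin 3))}
    (hU : IsOpen U) (hne : U.Nonempty) (M : ℝ) : SeqDoorAt (sinePhi U (cap ν M)) ν M :=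
  seqDoorAt_of_liouville hν h₁ (isWindowLsc_sinePhi U (cap_pos ν M)) (spreadsTo_sinePhi hν hU hne (cap_pos ν M))
    fun D _ => oneSliceLiouville_uni D

/-- pointwise form of the cap discharge: moments `ε`-parallel + cap respected ⇒ `Φ_sine ≤ ε`. -/
theorem sinePhi_le_of_moments {U : Set (EuclideanSpace ℝ (Fin 3))} {B ε : ℝ} (hB : 0 < B)
    {F : EuclideanSpace ℝ (Fin 3) → EuclideanSpace ℝ (Fin 3)} (hpen : ∀ ζ ∈ closure U, ‖F ζ‖ ≤ B)
    (hmom : ∀ g h : EuclideanSpace ℝ (Fin 3) → ℝ, IsTestWeight U g → IsTestWeight U h →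
      ‖cross (vortMoment g F) (vortMoment h F)‖ ≤ ε) : sinePhi U B F ≤ ENNReal.ofReal ε := by
  have htm : ∀ g, IsTestWeight U g → truncMoment B g F = vortMoment g F := by
    intro g hg
    unfold truncMoment vortMoment
    refine integral_congr_ae (Eventually.of_forall fun x => ?_)
    by_cases hx : x ∈ tsupport g
    · simp only [truncate_of_norm_le hB (hpen x (subset_closure (hg.2.2.1 hx)))]
    · simp only [gradient_eq_zero_off hx, ← crossCLM_apply, map_zero]
  simp only [sinePhi, capPenalty, if_pos hpen, zero_add]
  refine iSup_le fun g => iSup_le fun h => iSup_le fun hg => iSup_le fun hh => ?_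
  rw [htm g hg, htm h hh]
  exact ENNReal.ofReal_le_ofReal (hmom g h hg hh)

/-- pointwise (one time) form of §6: cap on the window + transverse vorticity mass `≤ δ` against a unit axis ⇒ the vorticity
moments are pairwise `2·cap·vol(U)·δ`-parallel. -/
theorem cross_moments_le_of_transverse {ν T M : ℝ} {u : ℝ → EuclideanSpace ℝ (Fin 3) → EuclideanSpace ℝ (Fin 3)}
    {p : ℝ → EuclideanSpace ℝ (Fin 3) → ℝ} (hcl : IsClassicalNSSolutionOn (Set.Ico 0 T) ν 0 u p) (x₀ : EuclideanSpace ℝ (Fin 3))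
    {U : Set (EuclideanSpace ℝ (Fin 3))} (hU : IsOpen U) (hUb : Bornology.IsBounded U) {t : ℝ} (ht : t ∈ Set.Ico 0 T)
    (hcap : ∀ ζ ∈ closure U, ‖physWindowField T x₀ u t ζ‖ ≤ cap ν M) {e : EuclideanSpace ℝ (Fin 3)} (he : ‖e‖ = 1)
    {δ : ℝ} (hδ : 0 ≤ δ)
    (hle : ∫⁻ ζ in U, ENNReal.ofReal ‖cross (curl (physWindowField T x₀ u t) ζ) e‖ ≤ ENNReal.ofReal δ) :
    ∀ g h : EuclideanSpace ℝ (Fin 3) → ℝ, IsTestWeight U g → IsTestWeight U h →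
      ‖cross (vortMoment g (physWindowField T x₀ u t)) (vortMoment h (physWindowField T x₀ u t))‖ ≤
        2 * (cap ν M * (volume U).toReal) * δ := by
  intro g h hg hh
  have hUfin : volume U ≠ ⊤ := hUb.measure_lt_top.ne
  set A : ℝ := cap ν M * (volume U).toReal with hA
  have hA0 : 0 ≤ A := mul_nonneg (cap_pos ν M).le ENNReal.toReal_nonneg
  set F := physWindowField T x₀ u t with hF
  have hF1 : ContDiff ℝ 1 F := contDiff_physWindowField hcl x₀ ht
  have hcurl : Continuous (curl F) := by
    rw [curl_eq_curlCLM_comp]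
    exact curlCLM.continuous.comp (hF1.continuous_fderiv (by simp))
  have hGc : Continuous fun x => ‖cross (curl F x) e‖ := (continuous_cross_comp hcurl continuous_const).norm
  have hint : IntegrableOn (fun x => ‖cross (curl F x) e‖) U volume :=
    (hGc.continuousOn.integrableOn_compact hUb.isCompact_closure).mono_set subset_closure
  have htransR : ∫ x in U, ‖cross (curl F x) e‖ ≤ δ := by
    have hnn : 0 ≤ᵐ[volume.restrict U] fun x => ‖cross (curl F x) e‖ := Eventually.of_forall fun x => norm_nonneg _
    rw [integral_eq_lintegral_of_nonneg_ae hnn hGc.aestronglyMeasurable.restrict, ← ENNReal.toReal_ofReal hδ]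
    exact ENNReal.toReal_mono ENNReal.ofReal_ne_top hle
  have hmg : ‖vortMoment g F‖ ≤ A := norm_vortMoment_le hU hUfin hg (cap_pos ν M).le hcap
  have hmh : ‖vortMoment h F‖ ≤ A := norm_vortMoment_le hU hUfin hh (cap_pos ν M).le hcap
  have htg : ‖cross (vortMoment g F) e‖ ≤ δ := (norm_cross_vortMoment_le hU hg hF1 e hint).trans htransR
  have hth : ‖cross (vortMoment h F) e‖ ≤ δ := (norm_cross_vortMoment_le hU hh hF1 e hint).trans htransR
  calc ‖cross (vortMoment g F) (vortMoment h F)‖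
      ≤ ‖vortMoment h F‖ * ‖cross (vortMoment g F) e‖ + ‖vortMoment g F‖ * ‖cross (vortMoment h F) e‖ :=
        norm_cross_le_of_unit _ _ he
    _ ≤ A * δ + A * δ := add_le_add (mul_le_mul hmh htg (norm_nonneg _) hA0) (mul_le_mul hmg hth (norm_nonneg _) hA0)
    _ = 2 * A * δ := by ring

/-- **door T-transverse-seq · `TargetTransverseVorticitySeq`** — the SEQUENTIAL form of T-transverse: for every `ν > 0`, `M`
and open bounded nonempty window `U` there is `δ = δ(ν, M, U) > 0` such that local Type I (`M`) at `(x₀, T)` together with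
— along SOME sequence of times `tₙ → T⁻` and for SOME unit axes `eₙ` — transverse window vorticity mass
`∫_U ‖Ω_{tₙ} × eₙ‖ ≤ δ` forces backward boundedness at `(x₀, T)`.  Equivalently: at a local Type-I singularity the
scale-normalised vorticity is, for ALL `t` close enough to `T`, NOT `δ`-unidirectional on the window `U` against ANY axis. -/
def TargetTransverseVorticitySeq : Prop :=
  ∀ (ν M : ℝ) (U : Set (EuclideanSpace ℝ (Fin 3))), 0 < ν → IsOpen U → Bornology.IsBounded U → U.Nonempty →
    ∃ δ : ℝ, 0 < δ ∧ ∀ (T : ℝ), 0 < T →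
    ∀ (u : ℝ → EuclideanSpace ℝ (Fin 3) → EuclideanSpace ℝ (Fin 3)) (p : ℝ → EuclideanSpace ℝ (Fin 3) → ℝ),
    IsClassicalNSSolutionOn (Set.Ico 0 T) ν 0 u p → IsLerayHopfOn T ν 0 (u 0) u → HasRapidSpatialDecay (u 0) →
    ∀ (x₀ : EuclideanSpace ℝ (Fin 3)) (ρ : ℝ), 0 < ρ →
    (∀ t ∈ Set.Ico 0 T, T - ρ ^ 2 < t → ∀ x ∈ Metric.ball x₀ ρ, ‖u t x‖ * (‖x - x₀‖ + Real.sqrt (ν * (T - t))) ≤ M) →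
    ∀ (t : ℕ → ℝ), (∀ n, t n < T) → Tendsto t atTop (𝓝 T) →
    (∀ n, ∃ e : EuclideanSpace ℝ (Fin 3), ‖e‖ = 1 ∧
      ∫⁻ ζ in U, ENNReal.ofReal ‖cross (curl (physWindowField T x₀ u (t n)) ζ) e‖ ≤ ENNReal.ofReal δ) →
    IsBackwardBoundedAt u T x₀

/-- **door T-transverse-seq MODULO I1** (`LocalPointZoomAlongTimesM`, the local point zoom along prescribed times — the one
remaining input of the sequential schema, being landed by the cell): PROVED from `seqDoorAt_sine`. -/
theorem targetTransverseVorticitySeq_of (h₁ : LocalPointZoomAlongTimesM) : TargetTransverseVorticitySeq := by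
  intro ν M U hν hU hUb hne
  obtain ⟨ε, hε, hdoor⟩ := seqDoorAt_sine h₁ hν hU hne M
  set A : ℝ := cap ν M * (volume U).toReal with hA
  have hA0 : 0 ≤ A := mul_nonneg (cap_pos ν M).le ENNReal.toReal_nonneg
  set δ : ℝ := ε / (2 * A + 1) with hδ
  have hδpos : 0 < δ := by rw [hδ]; positivity
  have hδε : 2 * A * δ ≤ ε := by
    have h1 : 2 * A * δ = ε - δ := by rw [hδ]; field_simp; ring
    rw [h1]; linarith
  refine ⟨δ, hδpos, fun T hT u p hcl hLH hdec x₀ ρ hρ hM t htlt htend htrans => ?_⟩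
  have hcapB : |M| / Real.sqrt ν < cap ν M := by unfold cap; linarith
  -- along the sequence, the cap is eventually respected and `tₙ ∈ (0, T)`
  have htendW : Tendsto t atTop (nhdsWithin T (Set.Iio T)) :=
    tendsto_nhdsWithin_iff.2 ⟨htend, Eventually.of_forall htlt⟩
  obtain ⟨N₀, hN₀⟩ := eventually_atTop.1
    (htendW.eventually ((eventually_norm_physWindowField_le hν hT hρ hM hUb.closure).and (Ioo_mem_nhdsLT hT)))
  refine hdoor T hT u p hcl hLH hdec x₀ ρ hρ hM (fun n => t (n + N₀)) (fun n => htlt _)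
    (htend.comp (tendsto_add_atTop_nat N₀)) fun n => ?_
  obtain ⟨hcap, ht0T⟩ := hN₀ (n + N₀) (Nat.le_add_left _ _)
  obtain ⟨e, he, hle⟩ := htrans (n + N₀)
  have hcap' : ∀ ζ ∈ closure U, ‖physWindowField T x₀ u (t (n + N₀)) ζ‖ ≤ cap ν M :=
    fun ζ hζ => (hcap ζ hζ).trans hcapB.le
  refine sinePhi_le_of_moments (cap_pos ν M) hcap' fun g h hg hh => ?_
  exact (cross_moments_le_of_transverse hcl x₀ hU hUb ⟨ht0T.1.le, ht0T.2⟩ hcap' he hδpos.le hle g h hg hh).trans hδε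

/-- **SEQUENTIAL sine door, UNCONDITIONAL** (I1 = tree `StableStrataDoorAlongTimes.localPointZoomAlongTimesM_holds`, landed
2026-08-28): `SeqDoorAt (sinePhi U (cap ν M)) ν M` for every `ν > 0`, `M`, open nonempty `U`. -/
theorem seqDoorAt_sine_holds {ν : ℝ} (hν : 0 < ν) {U : Set (EuclideanSpace ℝ (Fin 3))} (hU : IsOpen U) (hne : U.Nonempty)
    (M : ℝ) : SeqDoorAt (sinePhi U (cap ν M)) ν M :=
  seqDoorAt_sine StableStrataDoorAlongTimes.localPointZoomAlongTimesM_holds hν hU hne M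

/-- **door T-transverse-seq is a THEOREM** (unconditional). -/
theorem targetTransverseVorticitySeq_holds : TargetTransverseVorticitySeq :=
  targetTransverseVorticitySeq_of StableStrataDoorAlongTimes.localPointZoomAlongTimesM_holds

end Seq

end Summit.NavierStokesRegularity.NavierStokesRegularity.Theorems.SineMomentDoor

end
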